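import Literature.AlgebraicGeometry.AbelianSchemes.AbelianSchemeLDeltaFibreH1Vanishing
import Literature.AlgebraicGeometry.Morphisms.ProjectiveOfPushforwardFrameFieldExtension
import Literature.AlgebraicGeometry.AbelianVarieties.LefschetzThreeThetaVeryAmple
import Literature.AlgebraicGeometry.Resolution.ResolutionCharZero
import Mathlib.FieldTheory.IsAlgClosed.AlgebraicClosure
import HarnessLib

/-!
# The frame of `π_* L^Δ(λ)³` embeds a polarised abelian scheme into `ℙ^m_T` (F-6 functor side, the instantiation)

Layer `Literature/AlgebraicGeometry/AbelianSchemes`, namespace `Literature.AlgebraicGeometry.AbelianSchemes.AbelianSchemeOver`.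
THEOREMS ONLY (no definition, no named fact, no instance, no notation, no `sorry`).  Cell `hodgecm-mathlib` (D-0151), F-DAG F-6
«functor side (embedding half)», hand (FS-b) (B-plan1 (g16) 08:05:06Z; census `B-provers/B-p06/g12/CENSUS-FSb-PolarizedLevelFrameEmbedding.B-p06g12.md`;
road (x): the fibrewise binder of the generic assembly (FS-a) `Morphisms/ProjectiveOfPushforwardFrame` (B-p20 (g11)) is taken over a
FIELD EXTENSION of `κ(t)`, and this file discharges it at the GEOMETRIC point `κ(t)̄`).  Count-neutral capital: HC_CM is proved only
modulo the 7 printed citations until rung 0 closes — nothing here bears on a summit statement.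

[MumfordFogartyKirwan1994] Ch. 7 §2: Def. 7.5 (p. 130) makes the moduli functor of LINEARLY RIGIDIFIED polarised abelian schemes
«(A/T, λ, level, an isomorphism `𝒪_T^{m+1} ≅ π_*(L^Δ(λ)³)`)», and Prop. 7.6 (p. 136) / the proof of Thm. 7.9 (p. 139) embed such an
`A` into `ℙ^m_T` by the frame: on every geometric fibre `L^Δ(λ)³` restricts to the cube of an ample symmetric bundle (Prop. 6.10), which is
very ample with `H¹ = 0` (Prop. 6.13 / [MumfordAV1970] §16–§17), so «`π_*` commutes with base change» and the sections embed.

SETTING.  `T` a locally Noetherian `ℚ`-scheme (`πT : T → Spec ℚ`), `A/T` an abelian scheme (★ `AbelianSchemeOver`) with a dual pair `D`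
(★ `DualPair`) and a polarisation `pol` (★ `Polarization`), the graph datum `Gr = (1, λ) : A → A ×_T Â` (`hGr₁`, `hGr₂`; the convention of ★
`AbelianSchemeLDeltaOfLambda` / `AbelianSchemeLDeltaFibreH1Vanishing`), `M := L^Δ(λ)^{⊗3} = tensorPow (Gr^*𝒫) 3`, a rank-one frame system
`F` of `M`, and a frame `e : 𝒪^{m+1} ≅ (π_* M)|_T` of its direct image.  NO hypothesis binders: LEFSCHETZ «`3Θ` is very ample, base-point free» is ★
`AbelianVariety.isClosedImmersion_toProj_of_iso_lineBundle_three_nsmul` (`AbelianVarieties/LefschetzThreeThetaVeryAmple`, B-p15 (g12):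
module-iso-invariant head with derived `hcov`, over any field of characteristic `0`; used here over `κ(t)̄`).  The
spanning of the restricted frame sections on every field fibre is ★ `Morphisms.span_secMod_unitSectionLE_eq_top_of_frame_of_forall_fieldPoint`
(cohomology and base change, B-p20 (g11)), and the assembly is ★ `Morphisms/ProjectiveOfPushforwardFrameFieldExtension` (EGA III 4.7.1
in descent form).

* §1 **`Polarization.exists_isAmple_iso_restrict_LDelta_tensorPow_nsmul`** — at a geometric point `s̄`: `ι^*(L^Δ(λ)^{⊗m}) ≅ 𝒪(m • Θ)` with
  `Θ` AMPLE and SYMMETRIC (the exposed form of ★ `exists_symmetric_isAmple_iso_restrict_LDelta_tensorPow`: same class computation ★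
  `detClass_restrict_LDelta_eq_cechClass_add_pullback_neg`, ★ `nonempty_iso_iff_detClass_eq`).
* §2 **`Polarization.exists_hcov_isClosedImmersion_toProj_fibre_LDelta_three`** — at a geometric point over an algebraically closed `K` of
  characteristic `0`: any `K`-spanning family `s` of sections of `M|_{A_s̄}` generates it and embeds `A_s̄ ↪ ℙⁿ_K` (§1 at `m = 3` + ★ Lefschetz).
* §3 **`Polarization.forall_exists_fibre_embedding_of_frame_LDelta_three`** — for EVERY `t ∈ T`, over `κ(t)̄` (characteristic `0` by ★
  `charZero_residueField_of_over_field`), the canonical fibre `A ×_T Spec κ(t)̄` is embedded by the restricted frame sections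
  `η(b₀), …, η(b_m)` (§2 + cohomology and base change) — the per-point binder `H` of ★ `fibres_embedding_of_fieldExtension`, in its letter (extension `κ(t) → K`, presentation, `h1₀`, `s`, `hcov`,
  closed immersion);
  **`Polarization.isProjective_of_frame_LDelta_three`** — HEAD: `A → T` IS PROJECTIVE (★ `isProjective_of_pushforwardFrame` ∘ ★ `fibres_embedding_of_fieldExtension` fed
  with `hvan` := ★ V4 `Polarization.subsingleton_ext_one_pullback_LDelta_tensorPow'` and §3), and
  **`Polarization.isClosedImmersion_pointOfSections_of_frame_LDelta_three`** — the frame sections embed `A ↪ 𝐏(ι; T)` as a CLOSED IMMERSION.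

## References
* [MumfordFogartyKirwan1994] D. Mumford, J. Fogarty, F. Kirwan, *Geometric Invariant Theory*, 3rd ed. (1994), Ch. 6 §2 Prop. 6.10
  (p. 121), Def. 6.3 (p. 120); Ch. 7 §2 Prop. 7.3 (p. 132), Def. 7.5 (p. 130), Prop. 7.6 (p. 136).
* [MumfordAV1970] D. Mumford, *Abelian Varieties* (1970), §17 (the theorem of Lefschetz).
* [GortzWedhorn2023] U. Görtz, T. Wedhorn, *Algebraic Geometry II* (2023), Rem. 27.185 (p. 674).
-/

noncomputable section

-- Mathlib's `Over` monoidal API and `Scheme.Modules` section API are stated across semireducible wrappers.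
set_option backward.isDefEq.respectTransparency false

open CategoryTheory CategoryTheory.Limits AlgebraicGeometry MonoidalCategory CartesianMonoidalCategory
open CategoryTheory.Abelian
open scoped MonObj

universe u

namespace Literature.AlgebraicGeometry.AbelianSchemes

open Literature.AlgebraicGeometry.Motives Literature.AlgebraicGeometry.Modules
  Literature.AlgebraicGeometry.AbelianVarieties

namespace AbelianSchemeOver

/-! ## §1 At a geometric point: `ι_s^*(L^Δ(λ)^{⊗ m}) ≅ 𝒪(m • Θ)` with `Θ` ample (and symmetric) -/

section GeometricFibre

variable {S : Scheme.{u}} (A : AbelianSchemeOver S) (D : A.DualPair)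
  {Ω : Type u} [Field Ω] [IsAlgClosed Ω] (s : Spec (.of Ω) ⟶ S)
  {j : (A.fibre s).toAbelianVariety.X.left ⟶ A.X.left}

/-- **At a geometric point, `ι_s^*(L^Δ(λ)^{⊗ m}) ≅ 𝒪(m • Θ)` for an AMPLE SYMMETRIC `Θ`** — the exposed form of ★
`Polarization.exists_symmetric_isAmple_iso_restrict_LDelta_tensorPow` (there `Θ' = m • Θ` is hidden in the witness): for a
polarisation `λ` (`λ̄ = Λ(𝒪(Θ₀))`, `Θ₀` ample at the geometric point `s`), `Θ := Θ₀ + (−1)^*Θ₀` is ample and symmetric and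
`[ι_s^*L^Δ(λ)] = [Θ]` (★ `detClass_restrict_LDelta_eq_cechClass_add_pullback_neg`), so `[ι_s^*(L^Δ(λ)^{⊗m})] = m • [Θ] = [m • Θ]` and
rank-one modules with equal classes are isomorphic (★ `nonempty_iso_iff_detClass_eq`).  With `m = 3` this is the module the
Lefschetz embedding (`3 • Θ` very ample) speaks about.
[cite: MumfordFogartyKirwan1994, Ch. 6 §2 Prop. 6.10 (p. 121) and Def. 6.3 (p. 120)] [cite: GortzWedhorn2023, Rem. 27.185 (p. 674)] -/
theorem Polarization.exists_isAmple_iso_restrict_LDelta_tensorPow_nsmul (pol : A.Polarization D)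
    (hι : j = pullback.fst A.X.hom s)
    (Gr : A.X.left ⟶ A.prodLeft D.hat) (hGr₁ : Gr ≫ pullback.fst A.X.hom D.hat.X.hom = 𝟙 _)
    (hGr₂ : Gr ≫ pullback.snd A.X.hom D.hat.X.hom = pol.lam.left) (m : ℕ) :
    ∃ Θ : CartierDivisor (A.fibre s).toAbelianVariety.X.left, Θ.IsAmple ∧
      (Θ.pullback (AbelianVariety.Hom.toSchemeHom (-𝟙 (A.fibre s).toAbelianVariety))).LinEquiv Θ ∧
      Nonempty ((Scheme.Modules.pullback j).obj (tensorPow ((Scheme.Modules.pullback Gr).obj D.P) m) ≅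
        lineBundle (m • Θ).toUnitCocycle) := by
  obtain ⟨Θ₀, hΘ₀, hΛ⟩ := pol.exists_ample Ω s
  let B := (A.fibre s).toAbelianVariety
  let ν : B.X.left ⟶ B.X.left := AbelianVariety.Hom.toSchemeHom (-𝟙 B)
  have hνν : ν ≫ ν = 𝟙 B.X.left := by
    change AbelianVariety.Hom.toSchemeHom ((-𝟙 B) ≫ (-𝟙 B)) = 𝟙 B.X.left
    rw [Preadditive.neg_comp_neg, Category.comp_id]
    rfl
  haveI : IsIso ν := ⟨ν, hνν, hνν⟩
  let Θ : CartierDivisor B.X.left := Θ₀ + Θ₀.pullback ν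
  -- symmetric, ample
  have hsym : (Θ.pullback ν).LinEquiv Θ := by
    refine CartierDivisor.SameDivisor.linEquiv ?_
    refine (CartierDivisor.pullback_add_sameDivisor Θ₀ (Θ₀.pullback ν) ν).trans ?_
    refine CartierDivisor.SameDivisor.trans ?_ (CartierDivisor.add_comm_sameDivisor _ _)
    refine CartierDivisor.SameDivisor.add (CartierDivisor.SameDivisor.refl _) ?_
    refine (CartierDivisor.pullback_pullback_sameDivisor Θ₀ ν ν).trans ?_
    exact (Θ₀.pullback_congr_sameDivisor hνν).trans Θ₀.pullback_id_sameDivisor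
  have hamp : Θ.IsAmple := hΘ₀.add (hΘ₀.pullback ν)
  refine ⟨Θ, hamp, hsym, ?_⟩
  -- classes: `[j^*(L^{⊗m})] = [j^*L]^m = [Θ]^m = [m • Θ]`
  have hLΔ₁ : HasRank ((Scheme.Modules.pullback Gr).obj D.P) 1 := hasRank_pullback Gr D.hasRank_one
  have hL : IsFiniteLocallyFree ((Scheme.Modules.pullback j).obj ((Scheme.Modules.pullback Gr).obj D.P)) :=
    (HasRank.isFiniteLocallyFree' hLΔ₁).pullback j
  have hcl := A.detClass_restrict_LDelta_eq_cechClass_add_pullback_neg D s hι hΛ Gr hGr₁ hGr₂ hL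
  refine (nonempty_iso_iff_detClass_eq (hasRank_pullback j (hasRank_tensorPow_one hLΔ₁ m))
    (m • Θ).toUnitCocycle.hasRank_lineBundle ((isFiniteLocallyFree_tensorPow
      (HasRank.isFiniteLocallyFree' hLΔ₁) m).pullback j) (m • Θ).toUnitCocycle.isFiniteLocallyFree_lineBundle).2 ?_
  have hF : IsFiniteLocallyFree ((Scheme.Modules.pullback Gr).obj D.P) := HasRank.isFiniteLocallyFree' hLΔ₁
  rw [detClass_lineBundle_toUnitCocycle, detClass_pullback _ (isFiniteLocallyFree_tensorPow hF m),
    detClass_tensorPow hLΔ₁ hF m, map_pow, ← detClass_pullback _ hF, hcl, cechClass_smul']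

end GeometricFibre

/-! ## §2 The geometric fibres are embedded by the complete linear system of `L^Δ(λ)^{⊗3}` (Lefschetz, as a binder) -/

section FibreEmbedding

variable {T : Scheme.{0}} (A : AbelianSchemeOver T) (D : A.DualPair)

/-- **THE GEOMETRIC FIBRE `A_s̄` IS EMBEDDED BY ANY SPANNING FAMILY OF SECTIONS OF `L^Δ(λ)^{⊗3}|_{A_s̄}`** (modulo LEFSCHETZ):
for a polarisation `λ` with graph datum `Gr`, a rank-one frame system `F` of `M := L^Δ(λ)^{⊗3} = (Gr^*𝒫)^{⊗3}`, a geometric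
point `s̄ : Spec K → T` (`K` algebraically closed of characteristic `0`) with fibre `A_s̄ = A ×_T Spec K`, and a family `s` of global
sections of `M|_{A_s̄}` SPANNING them over `K`: the `s` generate `M|_{A_s̄}` and the morphism `A_s̄ → ℙⁿ_K` they define (★
`GeneratingSections.toProj`, read in the frames `F|_{A_s̄}`) is a CLOSED IMMERSION — because `M|_{A_s̄} ≅ 𝒪(3 • Θ)` for an ample
`Θ` (§1, [MumfordFogartyKirwan1994] Prop. 6.10: `L^Δ(λ)` restricts to `L₀²`-type ample bundles) and `3 • Θ` is very ample with
base-point-free complete linear system ([MumfordAV1970] §17 Lefschetz: ★ `AbelianVariety.isClosedImmersion_toProj_of_iso_lineBundle_three_nsmul`,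
the module-iso-invariant form with derived `hcov`).
[cite: MumfordFogartyKirwan1994, Ch. 6 §2 Prop. 6.10 (p. 121) and Ch. 7 §2 Prop. 7.3 (p. 132)] [cite: MumfordAV1970, §17 (Lefschetz theorem)] -/
theorem Polarization.exists_hcov_isClosedImmersion_toProj_fibre_LDelta_three (pol : A.Polarization D)
    (Gr : A.X.left ⟶ A.prodLeft D.hat) (hGr₁ : Gr ≫ pullback.fst A.X.hom D.hat.X.hom = 𝟙 _)
    (hGr₂ : Gr ≫ pullback.snd A.X.hom D.hat.X.hom = pol.lam.left)
    (F : FrameSystem (tensorPow ((Scheme.Modules.pullback Gr).obj D.P) 3)) (h1 : ∀ x, F.rank x = 1)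
    {K : Type} [Field K] [IsAlgClosed K] [CharZero K] (iK : Spec (.of K) ⟶ T) {n : ℕ}
    (s : Fin (n + 1) → Γ((Scheme.Modules.pullback (pullback.fst A.X.hom iK)).obj
      (tensorPow ((Scheme.Modules.pullback Gr).obj D.P) 3), ⊤))
    (hs : ∀ σ : Γ((Scheme.Modules.pullback (pullback.fst A.X.hom iK)).obj
        (tensorPow ((Scheme.Modules.pullback Gr).obj D.P) 3), ⊤),
      SecMod.mk (L := (Scheme.Modules.pullback (pullback.fst A.X.hom iK)).obj
          (tensorPow ((Scheme.Modules.pullback Gr).obj D.P) 3))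
        (ρ := (pullback.snd A.X.hom iK).appTop.hom) (U := ⊤) σ ∈
        Submodule.span Γ(Spec (.of K), ⊤) (Set.range fun j ↦
          SecMod.mk (L := (Scheme.Modules.pullback (pullback.fst A.X.hom iK)).obj
            (tensorPow ((Scheme.Modules.pullback Gr).obj D.P) 3))
            (ρ := (pullback.snd A.X.hom iK).appTop.hom) (U := ⊤) (s j))) :
    ∃ hcov : ⨆ i, ⨆ x, (pullback A.X.hom iK).basicOpen
        ((GeneratingSections.CocycleSections.ofFrameSystem (F.pullback (pullback.fst A.X.hom iK))
          (fun x => h1 ((pullback.fst A.X.hom iK).base x)) s).coeff i x) = ⊤,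
      IsClosedImmersion ((GeneratingSections.ofCocycleSections (F.pullback (pullback.fst A.X.hom iK)).U
        (GeneratingSections.CocycleSections.ofFrameSystem (F.pullback (pullback.fst A.X.hom iK)) (fun x => h1 ((pullback.fst A.X.hom iK).base x)) s)
        hcov).toProj (pullback.snd A.X.hom iK)) := by
  -- the geometric fibre as an abelian variety over `K`, integral
  let B : AbelianVariety K := (A.fibre iK).toAbelianVariety
  haveI : IsIntegral B.X.left :=
    haveI := B.geometricallyIntegral
    GeometricallyIntegral.isIntegral_of_subsingleton B.X.hom
  -- `M|_{A_s̄} ≅ 𝒪(3 • Θ)`, `Θ` ample (§1)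
  obtain ⟨Θ, hΘ, -, ⟨e⟩⟩ :=
    Polarization.exists_isAmple_iso_restrict_LDelta_tensorPow_nsmul A D iK (j := pullback.fst A.X.hom iK) pol rfl
      Gr hGr₁ hGr₂ 3
  exact B.isClosedImmersion_toProj_of_iso_lineBundle_three_nsmul hΘ _ e (F.pullback (pullback.fst A.X.hom iK))
    (fun x => h1 ((pullback.fst A.X.hom iK).base x)) s hs

end FibreEmbedding

/-! ## §3 Every point of `T`: the geometric fibre over `κ(t)̄`, embedded by the restricted FRAME sections -/

section Frame

variable {T : Scheme.{0}} (A : AbelianSchemeOver T) (D : A.DualPair)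

/-- **AT EVERY POINT OF THE BASE, THE FRAME SECTIONS EMBED THE GEOMETRIC FIBRE** — the per-point input of the functor-side
assembly «frame of `π_* M` + fibrewise (`H¹ = 0`, complete linear system embeds) ⇒ `A ↪ 𝐏^m_T`» (`Morphisms/ProjectiveOfPushforwardFrame`,
its per-`t` binder verbatim, over the field EXTENSION `κ(t) → κ(t)̄`): for `T` a locally Noetherian `ℚ`-scheme, a polarised abelian
scheme `(A, λ)` with graph datum `Gr`, `M := L^Δ(λ)^{⊗3}`, a rank-one frame system `F` of `M` and a frame
`e : 𝒪^{m+1} ≅ (π_* M)|_T` of its direct image — by LEFSCHETZ (★) and the SPANNING of the restricted frame sections on field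
fibres (★ `Morphisms.span_secMod_unitSectionLE_eq_top_of_frame_of_forall_fieldPoint` fed with `H¹(A_t, M_t) = 0` = ★ V4
`Polarization.subsingleton_ext_one_pullback_LDelta_tensorPow'`) — for every `t ∈ T`, over `K := κ(t)̄` (algebraically closed of
characteristic `0`, ★ `charZero_residueField_of_over_field`) the fibre `A ×_T Spec K` is embedded into `ℙ^m_K` by the restricted
frame sections `η(b₀), …, η(b_m)`, which generate `M|_{A ×_T Spec K}` (§2 at the canonical fibre).
[cite: MumfordFogartyKirwan1994, Ch. 7 §2 Prop. 7.3 (p. 132) and Def. 7.5 (p. 130)] [cite: MumfordAV1970, §17 (Lefschetz theorem)] -/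
theorem Polarization.forall_exists_fibre_embedding_of_frame_LDelta_three [IsLocallyNoetherian T] (πT : T ⟶ Spec (.of ℚ))
    (pol : A.Polarization D)
    (Gr : A.X.left ⟶ A.prodLeft D.hat) (hGr₁ : Gr ≫ pullback.fst A.X.hom D.hat.X.hom = 𝟙 _)
    (hGr₂ : Gr ≫ pullback.snd A.X.hom D.hat.X.hom = pol.lam.left)
    (F : FrameSystem (tensorPow ((Scheme.Modules.pullback Gr).obj D.P) 3)) (h1 : ∀ x, F.rank x = 1) {m : ℕ}
    (e : SheafOfModules.free (Fin (m + 1)) ≅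
      ((Scheme.Modules.pushforward A.X.hom).obj (tensorPow ((Scheme.Modules.pullback Gr).obj D.P) 3)).over ⊤)
    (t : T) :
    ∃ (K : Type) (_ : Field K) (j : T.residueField t →+* K) (X₀ : Scheme.{0}) (iX : X₀ ⟶ A.X.left)
      (f₀ : X₀ ⟶ Spec (.of K)) (_ : IsPullback iX f₀ A.X.hom (Spec.map (CommRingCat.ofHom j) ≫ T.fromSpecResidueField t))
      (h1₀ : ∀ x, (F.pullback iX).rank x = 1) (n : ℕ)
      (s : Fin (n + 1) → Γ((Scheme.Modules.pullback iX).obj (tensorPow ((Scheme.Modules.pullback Gr).obj D.P) 3), ⊤))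
      (hcov : ⨆ i, ⨆ x, X₀.basicOpen
        ((GeneratingSections.CocycleSections.ofFrameSystem (F.pullback iX) h1₀ s).coeff i x) = ⊤),
      IsClosedImmersion ((GeneratingSections.ofCocycleSections (F.pullback iX).U
        (GeneratingSections.CocycleSections.ofFrameSystem (F.pullback iX) h1₀ s) hcov).toProj f₀) := by
  -- the geometric point `Spec κ(t)̄ → Spec κ(t) → T`, of characteristic `0`
  haveI : CharZero (T.residueField t) := Resolution.charZero_residueField_of_over_field πT t
  let K : Type := AlgebraicClosure (T.residueField t)
  let j : T.residueField t →+* K := algebraMap (T.residueField t) K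
  let iK : Spec (.of K) ⟶ T := Spec.map (CommRingCat.ofHom j) ≫ T.fromSpecResidueField t
  -- the canonical fibre `A ×_T Spec K` and the restricted frame sections
  have HX : IsPullback (pullback.fst A.X.hom iK) (pullback.snd A.X.hom iK) A.X.hom iK := IsPullback.of_hasPullback _ _
  haveI : IsProper A.X.hom := A.isProper
  haveI : Smooth A.X.hom := A.isSmooth
  have hspan := Morphisms.span_secMod_unitSectionLE_eq_top_of_frame_of_forall_fieldPoint A.X.hom
    (tensorPow ((Scheme.Modules.pullback Gr).obj D.P) 3) F.isFiniteLocallyFree e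
    (fun K _ X₀ i f₀ x H ↦ pol.subsingleton_ext_one_pullback_LDelta_tensorPow' A D Gr hGr₁ hGr₂ x H (by norm_num)) HX
  obtain ⟨hcov, himm⟩ := Polarization.exists_hcov_isClosedImmersion_toProj_fibre_LDelta_three A D pol Gr hGr₁ hGr₂ F h1
    iK (fun i ↦ unitSectionLE (pullback.fst A.X.hom iK) (tensorPow ((Scheme.Modules.pullback Gr).obj D.P) 3)
      (V := ⊤) (U := ⊤) le_top (basisSection e i :)) (fun σ ↦ by rw [hspan]; exact Submodule.mem_top)
  exact ⟨K, inferInstance, j, _, pullback.fst A.X.hom iK, pullback.snd A.X.hom iK, HX,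
    fun x => h1 ((pullback.fst A.X.hom iK).base x), m, _, hcov, himm⟩

/-- **THE FRAME OF `π_* L^Δ(λ)³` EMBEDS THE POLARISED ABELIAN SCHEME: `A ↪ 𝐏^m_T` IS A CLOSED IMMERSION, `A → T` IS PROJECTIVE**
([MumfordFogartyKirwan1994] Ch. 7 §2, Def. 7.5 / Prop. 7.6 and the proof of Thm. 7.9: a `T`-valued point `(A/T, λ, level, frame of
π_* L^Δ(λ)³)` of the moduli functor defines `A ↪ ℙ^m_T`).  The instantiation of the generic functor-side assembly
★ `Morphisms.isProjective_of_pushforwardFrame` with its per-point binder supplied by ★ `Morphisms.fibres_embedding_of_fieldExtension`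
(«rank-one frames of `E` + a frame of `π_*E` + fibrewise `H¹ = 0` + every point has a field EXTENSION over which the fibre is embedded
by finitely many sections ⇒ `IsProjective`») at `E := L^Δ(λ)^{⊗3}`: `hvan` is ★ V4 `Polarization.subsingleton_ext_one_pullback_LDelta_tensorPow'` (the `[n]`-trick), and the per-point
embedding is `forall_exists_fibre_embedding_of_frame_LDelta_three` (★ Lefschetz at the geometric point `κ(t)̄`, restricted frame
sections spanning by cohomology and base change).  The level structure of a `PolarizedAbelianSchemeWithLevel` plays no role.
[cite: MumfordFogartyKirwan1994, Ch. 7 §2 Def. 7.5 (p. 130), Prop. 7.6 (p. 136) and Prop. 7.3 (p. 132)] [cite: MumfordAV1970, §17 (Lefschetz theorem)] -/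
theorem Polarization.isProjective_of_frame_LDelta_three [IsLocallyNoetherian T] (πT : T ⟶ Spec (.of ℚ))
    (pol : A.Polarization D)
    (Gr : A.X.left ⟶ A.prodLeft D.hat) (hGr₁ : Gr ≫ pullback.fst A.X.hom D.hat.X.hom = 𝟙 _)
    (hGr₂ : Gr ≫ pullback.snd A.X.hom D.hat.X.hom = pol.lam.left)
    (F : FrameSystem (tensorPow ((Scheme.Modules.pullback Gr).obj D.P) 3)) (h1 : ∀ x, F.rank x = 1) {m : ℕ}
    (e : SheafOfModules.free (Fin (m + 1)) ≅
      ((Scheme.Modules.pushforward A.X.hom).obj (tensorPow ((Scheme.Modules.pullback Gr).obj D.P) 3)).over ⊤) :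
    Morphisms.IsProjective A.X.hom := by
  haveI : IsProper A.X.hom := A.isProper
  haveI : Smooth A.X.hom := A.isSmooth
  exact Morphisms.isProjective_of_pushforwardFrame A.X.hom F h1 e
    (fun K _ X₀ i f₀ x H ↦ pol.subsingleton_ext_one_pullback_LDelta_tensorPow' A D Gr hGr₁ hGr₂ x H (by norm_num))
    (Morphisms.fibres_embedding_of_fieldExtension A.X.hom F h1 e
      (fun K _ X₀ i f₀ x H ↦ pol.subsingleton_ext_one_pullback_LDelta_tensorPow' A D Gr hGr₁ hGr₂ x H (by norm_num))
      (Polarization.forall_exists_fibre_embedding_of_frame_LDelta_three A D πT pol Gr hGr₁ hGr₂ F h1 e))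

/-- **… and the frame sections define a CLOSED IMMERSION `A ↪ 𝐏(J; T)` over `T`** (frame indexed by the `#J + 1` homogeneous
coordinates, as in ★ `exists_isClosedImmersion_pointOfSections_of_fieldExtension`): [MumfordFogartyKirwan1994] Prop. 7.6 /
proof of Thm. 7.9 «the linear rigidification `𝒪^{m+1} ≅ π_*(L^Δ(λ)³)` embeds `A ⊂ ℙ^m_T`».
[cite: MumfordFogartyKirwan1994, Ch. 7 §2 Def. 7.5 (p. 130), Prop. 7.6 (p. 136) and Prop. 7.3 (p. 132)] [cite: MumfordAV1970, §17 (Lefschetz theorem)] -/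
theorem Polarization.isClosedImmersion_pointOfSections_of_frame_LDelta_three [IsLocallyNoetherian T] (πT : T ⟶ Spec (.of ℚ))
    (pol : A.Polarization D)
    (Gr : A.X.left ⟶ A.prodLeft D.hat) (hGr₁ : Gr ≫ pullback.fst A.X.hom D.hat.X.hom = 𝟙 _)
    (hGr₂ : Gr ≫ pullback.snd A.X.hom D.hat.X.hom = pol.lam.left)
    (F : FrameSystem (tensorPow ((Scheme.Modules.pullback Gr).obj D.P) 3)) (h1 : ∀ x, F.rank x = 1) (J : Type)
    (e : SheafOfModules.free (Fin (Nat.card J + 1)) ≅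
      ((Scheme.Modules.pushforward A.X.hom).obj (tensorPow ((Scheme.Modules.pullback Gr).obj D.P) 3)).over ⊤) :
    ∃ hcov, IsClosedImmersion (Morphisms.projectiveSpace.pointOfSections (Over.mk A.X.hom)
      (GeneratingSections.ofCocycleSections F.U
        (GeneratingSections.CocycleSections.ofFrameSystem F h1 fun j ↦ (basisSection e j :)) hcov)).left := by
  haveI : IsProper A.X.hom := A.isProper
  haveI : Smooth A.X.hom := A.isSmooth
  exact Morphisms.exists_isClosedImmersion_pointOfSections_of_fieldExtension A.X.hom F h1 J e
    (fun K _ X₀ i f₀ x H ↦ pol.subsingleton_ext_one_pullback_LDelta_tensorPow' A D Gr hGr₁ hGr₂ x H (by norm_num))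
    (Polarization.forall_exists_fibre_embedding_of_frame_LDelta_three A D πT pol Gr hGr₁ hGr₂ F h1 e)

end Frame

end AbelianSchemeOver

end Literature.AlgebraicGeometry.AbelianSchemes

end
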